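import Summits.ResolutionOfSingularities.ResolutionOfSingularities.Theorems.ValuativeLuAlphaPTorsorAdaptedValueStepTheta
import HarnessLib

/-!
# Adapted value step, VII: saturation of the high ideals of `R[y]`

Crux `Valuative.LuAlphaPTorsor` (stmt-ResolutionOfSingularities-0641), line `pfaff-line-log-final-forms`,
registered stub `stub_adaptedValueStep` (F6v, wave 2: the ADAPTED value step of the purely
inseparable tower, any rank) — helper file 7/8.

`adValue_satur_core`: if `z ∈ R₁ = R[y]` is smaller than every Laurent monomial in the `y_j` of
level `< ℓ`, then `y^g · z` lies in the ideal `(y_h : lv' h ≥ ℓ) R₁` for some `g` supported on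
the levels `< ℓ`. Proof: write `z` as a polynomial in `y` over `R`; its high part is in the
ideal; each low monomial is `θ^s x^E u^Q` (`adValue_theta`); clearing the `x`-denominators by old
parameters of level `< ℓ₁` regroups `x^N ·(low part)` as `∑ θ^s G_s` with `G_s ∈ R`, all `G_s`
small by `adValue_theta_separation`, hence in the level-`ℓ₁` ideal of `R`, whose generators lie
in `(y_h : lv' h ≥ ℓ) R₁`; finally `x^N` and a power of the denominator of `θ` are low
`y`-monomials times units. [folklore]
-/

noncomputable section

-- `Summit.<S>.<S>.…` duplicates the summit name by design (D-0017, single-problem summit).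
set_option linter.dupNamespace false

open IsLocalRing

namespace Summit.ResolutionOfSingularities.ResolutionOfSingularities.Theorems.PfaffLine

open Literature.AlgebraicGeometry.Resolution

section Saturation

variable {k K : Type} [Field k] [Field K] [Algebra k K] (O : ValuationSubring K) {n : ℕ}

/-- **Saturation core of the adapted value step.** In the setting of the value step with the
flag-adapted input chart `(R, x, lv)` and the re-based parameters `y` (values flag-adapted for
`lv'`, `xᵢ = y^{cᵢ} wᵢ`), fix a level `ℓ` of `y`. If `z ∈ R[y]` is smaller than every Laurent
monomial in the `y_j` of level `< ℓ`, then a monomial multiple `y^g z`, `g` supported on the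
levels `< ℓ`, lies in the ideal of `R[y]` generated by the `y_h` of level `≥ ℓ`. -/
theorem adValue_satur_core {p : ℕ} (hp : p.Prime)
    (R : Subalgebra k K) (hRO : R.toSubring ≤ O.toSubring) (x : Fin n → K) (hx : ∀ i, x i ∈ R)
    (lv : Fin n → ℕ) (hx0 : ∀ i, x i ≠ 0)
    (hind : ∀ m : Fin n → ℤ, (∏ i, O.valuation (x i) ^ (m i)) = 1 → m = 0)
    (hC2a : ∀ i i', lv i < lv i' → ∀ m : Fin n → ℤ, (∀ j, lv i < lv j → m j = 0) →
      O.valuation (x i') < ∏ j, O.valuation (x j) ^ (m j))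
    (hC4 : ∀ (ℓ : ℕ) (μ : Fin n → ℤ), (∀ j, lv j ≠ ℓ → μ j = 0) → μ ≠ 0 →
      (∀ m : Fin n → ℤ, (∀ j, ℓ ≤ lv j → m j = 0) →
        (∏ j, O.valuation (x j) ^ (μ j)) < ∏ j, O.valuation (x j) ^ (m j)) ∨
      (∀ m : Fin n → ℤ, (∀ j, ℓ ≤ lv j → m j = 0) →
        (∏ j, O.valuation (x j) ^ (m j)) < ∏ j, O.valuation (x j) ^ (μ j)))
    (hLA : LevelArchimedean (fun i => O.valuation (x i)) lv)
    (hC3 : ∀ (ℓ : ℕ) (z : R.toSubring),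
      z ∈ Ideal.span (Set.range fun i : {i : Fin n // ℓ ≤ lv i} => (⟨x i.1, hx i.1⟩ : R.toSubring)) ↔
        ∀ m : Fin n → ℤ, (∀ j, ℓ ≤ lv j → m j = 0) →
          O.valuation (z : K) < ∏ j, O.valuation (x j) ^ (m j))
    (t u : K) (α : Fin n → ℕ) (huR : u ∈ R) (huiR : u⁻¹ ∈ R) (hvu : O.valuation u = 1)
    (htp : t ^ p = (∏ i, x i ^ (α i)) * u)
    (hvt : ∀ m : Fin n → ℤ, O.valuation t ≠ ∏ i, O.valuation (x i) ^ (m i))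
    (y : Fin n → K) (lv' : Fin n → ℕ) (hy0 : ∀ j, y j ≠ 0) (hvy1 : ∀ j, O.valuation (y j) < 1)
    (hC2a' : ∀ i i', lv' i < lv' i' → ∀ m : Fin n → ℤ, (∀ j, lv' i < lv' j → m j = 0) →
      O.valuation (y i') < ∏ j, O.valuation (y j) ^ (m j))
    (hymono : ∀ j, ∃ (a : Fin n → ℤ) (b : ℤ), y j = (∏ i, x i ^ (a i)) * t ^ b)
    (c : Fin n → Fin n → ℕ) (w : Fin n → K) (hw : ∀ i, w i ∈ R) (hwi : ∀ i, (w i)⁻¹ ∈ R)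
    (hxw : ∀ i, x i = (∏ j, y j ^ (c i j)) * w i)
    (hR₁O : (Algebra.adjoin k ((R : Set K) ∪ Set.range y)).toSubring ≤ O.toSubring)
    (ℓ : ℕ) (z : K)
    (hz : ∃ P : MvPolynomial (Fin n) K, (∀ μ, P.coeff μ ∈ R) ∧ MvPolynomial.eval y P = z)
    (hsmall : ∀ m : Fin n → ℤ, (∀ j, ℓ ≤ lv' j → m j = 0) →
      O.valuation z < ∏ j, O.valuation (y j) ^ (m j)) :
    ∃ g : Fin n → ℕ, (∀ j, ℓ ≤ lv' j → g j = 0) ∧ ∃ b : Fin n → K,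
      (∀ h, b h ∈ Algebra.adjoin k ((R : Set K) ∪ Set.range y)) ∧
      (∏ j, y j ^ (g j)) * z = ∑ h ∈ Finset.univ.filter (fun h => ℓ ≤ lv' h), y h * b h := by
  classical
  -- ### the ring `R₁ = R[y]` and the target form `J`
  set R₁ : Subalgebra k K := Algebra.adjoin k ((R : Set K) ∪ Set.range y) with hR₁
  have hRR₁ : R ≤ R₁ := fun z hz => Algebra.subset_adjoin (Or.inl hz)
  have hyR₁ : ∀ j, y j ∈ R₁ := fun j => Algebra.subset_adjoin (Or.inr ⟨j, rfl⟩)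
  set Hset := Finset.univ.filter (fun h => ℓ ≤ lv' h) with hHset
  let J : K → Prop := fun z => ∃ b : Fin n → K, (∀ h, b h ∈ R₁) ∧ z = ∑ h ∈ Hset, y h * b h
  have J0 : J 0 := ⟨0, fun _ => R₁.zero_mem, by simp⟩
  have Jadd : ∀ z₁ z₂, J z₁ → J z₂ → J (z₁ + z₂) := by
    rintro z₁ z₂ ⟨b₁, hb₁, rfl⟩ ⟨b₂, hb₂, rfl⟩
    refine ⟨b₁ + b₂, fun h => R₁.add_mem (hb₁ h) (hb₂ h), ?_⟩
    rw [← Finset.sum_add_distrib]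
    exact Finset.sum_congr rfl fun h _ => by rw [Pi.add_apply, mul_add]
  have Jmul : ∀ z r, J z → r ∈ R₁ → J (z * r) := by
    rintro z r ⟨b, hb, rfl⟩ hr
    refine ⟨fun h => b h * r, fun h => R₁.mul_mem (hb h) hr, ?_⟩
    rw [Finset.sum_mul]
    exact Finset.sum_congr rfl fun h _ => by rw [mul_assoc]
  have Jsum : ∀ {ι : Type} (s : Finset ι) (f : ι → K), (∀ a ∈ s, J (f a)) → J (∑ a ∈ s, f a) := by
    intro ι s f hf
    induction s using Finset.induction_on with
    | empty => simpa using J0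
    | insert a s ha ih =>
      rw [Finset.sum_insert ha]
      exact Jadd _ _ (hf a (Finset.mem_insert_self _ _)) (ih fun b hb => hf b (Finset.mem_insert_of_mem hb))
  have Jgen : ∀ h ∈ Hset, ∀ r ∈ R₁, J (y h * r) := by
    intro h hh r hr
    refine ⟨fun h' => if h' = h then r else 0, fun h' => ?_, ?_⟩
    · by_cases hh' : h' = h
      · simp only [if_pos hh']; exact hr
      · simp only [if_neg hh']; exact R₁.zero_mem
    · simp only [mul_ite, mul_zero, Finset.sum_ite_eq', if_pos hh]
  -- monomials touching the levels `≥ ℓ` are in `J`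
  have Jmono : ∀ r ∈ R₁, ∀ (e : Fin n → ℕ) (h : Fin n), ℓ ≤ lv' h → e h ≠ 0 →
      J (r * ∏ j, y j ^ (e j)) := by
    intro r hr e h hh heh
    have hsplit : (∏ j, y j ^ (e j)) = y h * (y h ^ (e h - 1) * ∏ j ∈ Finset.univ.erase h, y j ^ (e j)) := by
      rw [← Finset.mul_prod_erase Finset.univ _ (Finset.mem_univ h), ← mul_assoc, ← pow_succ',
        Nat.sub_add_cancel (Nat.one_le_iff_ne_zero.mpr heh)]
    rw [hsplit, mul_left_comm]
    exact Jgen h (Finset.mem_filter.mpr ⟨Finset.mem_univ _, hh⟩) _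
      (R₁.mul_mem hr (R₁.mul_mem (R₁.pow_mem (hyR₁ h) _)
        (R₁.prod_mem fun j _ => R₁.pow_mem (hyR₁ j) _)))
  -- ### smallness below the level `ℓ` of `y`
  have hvy0 : ∀ j, O.valuation (y j) ≠ 0 := fun j => (map_ne_zero _).mpr (hy0 j)
  have hvx0 : ∀ i, O.valuation (x i) ≠ 0 := fun i => (map_ne_zero _).mpr (hx0 i)
  have hY0 := adValue_prod_zpow_ne_zero (fun j => O.valuation (y j)) hvy0
  have small_mono : ∀ (z θ' : K) (ν : Fin n → ℤ), (∀ j, ℓ ≤ lv' j → ν j = 0) →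
      O.valuation θ' = ∏ j, O.valuation (y j) ^ (ν j) →
      (∀ m : Fin n → ℤ, (∀ j, ℓ ≤ lv' j → m j = 0) →
        O.valuation z < ∏ j, O.valuation (y j) ^ (m j)) →
      ∀ m : Fin n → ℤ, (∀ j, ℓ ≤ lv' j → m j = 0) →
        O.valuation (θ' * z) < ∏ j, O.valuation (y j) ^ (m j) := by
    intro z θ' ν hν hθ' hz m hm
    rw [map_mul, hθ']
    have h := hz (m - ν) fun j hj => by rw [Pi.sub_apply, hm j hj, hν j hj, sub_zero]
    rw [adValue_prod_zpow_sub _ hvy0, lt_mul_inv_iff₀ (zero_lt_iff.mpr (hY0 ν)), mul_comm] at h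
    exact h
  have Jsmall : ∀ z, J z → ∀ m : Fin n → ℤ, (∀ j, ℓ ≤ lv' j → m j = 0) →
      O.valuation z < ∏ j, O.valuation (y j) ^ (m j) := by
    rintro z ⟨b, hb, rfl⟩
    refine adValue_small_sum O y lv' hy0 _ _ ℓ fun h hh => ?_
    exact adValue_small_mul O y lv' ((O.valuation_le_one_iff _).mpr (hR₁O (hb h))) ℓ
      (adValue_yhigh_small O y lv' hvy1 hC2a' ℓ h (Finset.mem_filter.mp hh).2)
  -- ### the level cut and the element `θ`
  obtain ⟨ℓ₁, hℓ₁, hℓ₁'⟩ :=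
    adValue_level_cut O R hRO x hx lv hx0 hC2a hLA hC3 y lv' hy0 hvy1 hC2a' c w hw hwi hxw ℓ
  have hE := adValue_no_defect O R hRO x hx lv hx0 hC4 hLA hC3 y lv' hy0 hvy1 hC2a' c w hw
    hwi hxw ℓ ℓ₁ hℓ₁ hℓ₁'
  choose af bf hyab using hymono
  obtain ⟨θ, ν₁, hν₁, hθν, hθ0, hdecomp⟩ :=
    adValue_theta O hp x hx0 hind lv t u α hvu htp hvt y lv' hy0 af bf hyab ℓ ℓ₁
      (fun m hm => hE m hm)
  -- low `x`-monomials are low `y`-monomials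
  have hXlow : ∀ m : Fin n → ℤ, (∀ i, ℓ₁ ≤ lv i → m i = 0) →
      ∃ κ : Fin n → ℤ, (∀ j, ℓ ≤ lv' j → κ j = 0) ∧
        (∏ i, O.valuation (x i) ^ (m i)) = ∏ j, O.valuation (y j) ^ (κ j) := by
    intro m hm
    refine ⟨_, fun j hj => ?_, adValue_vxmono O R hRO x hx0 y hy0 c w hw hwi hxw m⟩
    simp only [Finset.sum_apply, Pi.smul_apply, smul_eq_mul]
    refine Finset.sum_eq_zero fun i _ => ?_
    by_cases hi : ℓ₁ ≤ lv i
    · rw [hm i hi, zero_mul]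
    · have hci : c i j = 0 := by
        by_contra hc
        exact hi ((hℓ₁ i).mp ⟨j, hj, hc⟩)
      rw [hci, Nat.cast_zero, mul_zero]
  -- old parameters of level `≥ ℓ₁` generate elements of `J`
  have JxS : ∀ i, ℓ₁ ≤ lv i → ∀ r ∈ R₁, J (x i * r) := by
    intro i hi r hr
    obtain ⟨h, hh, hch⟩ := (hℓ₁ i).mpr hi
    rw [hxw i, mul_assoc, mul_comm]
    exact Jmono _ (R₁.mul_mem (hRR₁ (hw i)) hr) (c i) h hh hch
  have JI : ∀ r : K, ∀ hr : r ∈ R, (⟨r, hr⟩ : R.toSubring) ∈ Ideal.span (Set.range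
      fun i : {i : Fin n // ℓ₁ ≤ lv i} => (⟨x i.1, hx i.1⟩ : R.toSubring)) →
      ∀ r' ∈ R₁, J (r * r') := by
    intro r hr hmem r' hr'
    obtain ⟨d, hdR, hd0, hrd⟩ := (adValue_mem_levelIdeal_iff R x hx lv ℓ₁ hr).mp hmem
    rw [hrd, Finset.sum_mul]
    refine Jsum _ _ fun i _ => ?_
    by_cases hi : ℓ₁ ≤ lv i
    · rw [mul_assoc]
      exact JxS i hi _ (R₁.mul_mem (hRR₁ (hdR i)) hr')
    · rw [hd0 i (not_le.mp hi), mul_zero, zero_mul]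
      exact J0
  -- ### the polynomial and its splitting
  obtain ⟨P, hPR, hPz⟩ := hz
  set f : (Fin n →₀ ℕ) → K := fun μ => P.coeff μ * ∏ j, y j ^ (μ j) with hf
  set FL := P.support.filter fun μ => ∀ j, ℓ ≤ lv' j → μ j = 0 with hFL
  set FH := P.support.filter fun μ => ¬ ∀ j, ℓ ≤ lv' j → μ j = 0 with hFH
  have hzsplit : z = (∑ μ ∈ FL, f μ) + ∑ μ ∈ FH, f μ := by
    rw [Finset.sum_filter_add_sum_filter_not, ← MvPolynomial.eval_eq', hPz]
  have JH : J (∑ μ ∈ FH, f μ) := by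
    refine Jsum _ _ fun μ hμ => ?_
    have h := (Finset.mem_filter.mp hμ).2
    push Not at h
    obtain ⟨h, hh, hμh⟩ := h
    exact Jmono _ (hRR₁ (hPR μ)) _ h hh hμh
  have hzLsmall : ∀ m : Fin n → ℤ, (∀ j, ℓ ≤ lv' j → m j = 0) →
      O.valuation (∑ μ ∈ FL, f μ) < ∏ j, O.valuation (y j) ^ (m j) := by
    intro m hm
    have heq : (∑ μ ∈ FL, f μ) = z + -(∑ μ ∈ FH, f μ) := by rw [hzsplit]; ring
    rw [heq]
    refine Valuation.map_add_lt _ (hsmall m hm) ?_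
    rw [Valuation.map_neg]
    exact Jsmall _ JH m hm
  -- ### Laurent monomials in `x, t`
  have ht0 : t ≠ 0 := adValue_t_ne_zero O hp.ne_zero x hx0 t u α hvu htp
  have mono_yμ : ∀ μ : Fin n →₀ ℕ, ∃ (a : Fin n → ℤ) (b : ℤ),
      (∏ j, y j ^ (μ j)) = (∏ i, x i ^ (a i)) * t ^ b := fun μ =>
    adValue_exists_mono x hx0 t ht0 y af bf hyab μ
  -- ### decomposition of the low monomials of `P`
  have hdm : ∀ μ : Fin n →₀ ℕ, ∃ (s : ℕ) (E : Fin n → ℤ) (Q : ℤ), μ ∈ FL →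
      s < p ∧ (∀ i, ℓ₁ ≤ lv i → E i = 0) ∧
        (∏ j, y j ^ (μ j)) = θ ^ s * (∏ i, x i ^ (E i)) * u ^ Q ∧
        (s ≠ 0 → ∀ (s' : ℕ) (m : Fin n → ℤ), 0 < s' → s' < p →
          O.valuation θ ^ s' ≠ ∏ i, O.valuation (x i) ^ (m i)) := by
    intro μ
    by_cases hμ : μ ∈ FL
    · obtain ⟨a, b, hab⟩ := mono_yμ μ
      obtain ⟨s, E, Q, hs, hEs, hdec, hsep⟩ := hdecomp a b ⟨fun j => (μ j : ℤ), fun j hj => by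
          simp only [(Finset.mem_filter.mp hμ).2 j hj, Nat.cast_zero], by
        rw [← hab, valuation_prod_pow O y]
        exact Finset.prod_congr rfl fun j _ => (zpow_natCast _ _).symm⟩
      exact ⟨s, E, Q, fun _ => ⟨hs, hEs, hab.trans hdec, hsep⟩⟩
    · exact ⟨0, 0, 0, fun h => (hμ h).elim⟩
  choose sf Ef Qf hdm using hdm
  -- ### clearing the `x`-denominators with old parameters of level `< ℓ₁`
  set N : Fin n → ℕ := fun i => FL.sup fun μ => (-Ef μ i).toNat with hN
  have hNE : ∀ μ ∈ FL, ∀ i, 0 ≤ (N i : ℤ) + Ef μ i := by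
    intro μ hμ i
    have h1 : (-Ef μ i).toNat ≤ N i := Finset.le_sup (f := fun μ => (-Ef μ i).toNat) hμ
    have h2 := Int.self_le_toNat (-Ef μ i)
    omega
  have hN0 : ∀ i, ℓ₁ ≤ lv i → N i = 0 := by
    intro i hi
    refine le_antisymm (Finset.sup_le fun μ hμ => ?_) (Nat.zero_le _)
    simp [(hdm μ hμ).2.1 i hi]
  set xN : K := ∏ i, x i ^ (N i) with hxN
  have hxNR : xN ∈ R := R.prod_mem fun i _ => R.pow_mem (hx i) _
  -- `xN · x^{E μ} ∈ R`
  set GE : (Fin n →₀ ℕ) → K := fun μ => ∏ i, x i ^ (((N i : ℤ) + Ef μ i).toNat) with hGE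
  have hGER : ∀ μ, GE μ ∈ R := fun μ => R.prod_mem fun i _ => R.pow_mem (hx i) _
  have hGEeq : ∀ μ ∈ FL, xN * ∏ i, x i ^ (Ef μ i) = GE μ := by
    intro μ hμ
    have h1 : xN = ∏ i, x i ^ ((fun i => (N i : ℤ)) i) :=
      Finset.prod_congr rfl fun i _ => (zpow_natCast _ _).symm
    rw [h1, ← prod_zpow_add_eq x hx0]
    refine Finset.prod_congr rfl fun i _ => ?_
    rw [← zpow_natCast, Int.toNat_of_nonneg (hNE μ hμ i), Pi.add_apply]
  -- ### regrouping along the exponent of `θ`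
  set G : ℕ → K := fun s => ∑ μ ∈ FL.filter (fun μ => sf μ = s), P.coeff μ * u ^ (Qf μ) * GE μ
    with hG
  have hGR : ∀ s, G s ∈ R := fun s => R.sum_mem fun μ _ =>
    R.mul_mem (R.mul_mem (hPR μ) (valueStep_zpow_mem R huR huiR _)) (hGER μ)
  have hterm : ∀ μ ∈ FL, xN * f μ = θ ^ (sf μ) * (P.coeff μ * u ^ (Qf μ) * GE μ) := by
    intro μ hμ
    simp only [hf]
    rw [← hGEeq μ hμ, (hdm μ hμ).2.2.1]
    ring
  have hregroup : xN * ∑ μ ∈ FL, f μ = ∑ s ∈ Finset.range p, θ ^ s * G s := by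
    rw [Finset.mul_sum, Finset.sum_congr rfl hterm,
      ← Finset.sum_fiberwise_of_maps_to (s := FL) (t := Finset.range p) (g := sf)
        (fun μ hμ => Finset.mem_range.mpr (hdm μ hμ).1)]
    refine Finset.sum_congr rfl fun s _ => ?_
    rw [hG, Finset.mul_sum]
    refine Finset.sum_congr rfl fun μ hμ => ?_
    rw [(Finset.mem_filter.mp hμ).2]
  have htotsmall : ∀ m : Fin n → ℤ, (∀ j, ℓ ≤ lv' j → m j = 0) →
      O.valuation (∑ s ∈ Finset.range p, θ ^ s * G s) < ∏ j, O.valuation (y j) ^ (m j) := by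
    rw [← hregroup]
    intro m hm
    rw [mul_comm]
    exact adValue_small_mul O y lv' ((O.valuation_le_one_iff _).mpr (hRO hxNR)) ℓ hzLsmall m hm
  -- values of the powers of `θ`
  have hvθs : ∀ s : ℕ, O.valuation (θ ^ s) = ∏ j, O.valuation (y j) ^ (((s : ℤ) • ν₁) j) := by
    intro s
    rw [prod_zpow_smul_eq, zpow_natCast, map_pow, hθν, valuation_prod_zpow y O]
  have hsν₁ : ∀ s : ℕ, ∀ j, ℓ ≤ lv' j → ((s : ℤ) • ν₁) j = 0 := fun s j hj => by
    rw [Pi.smul_apply, smul_eq_mul, hν₁ j hj, mul_zero]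
  -- ### every `G s` is small (separation of the powers of `θ`)
  have hsepG : ∀ s ∈ Finset.range p, (¬ ∀ m : Fin n → ℤ, (∀ j, ℓ ≤ lv' j → m j = 0) →
        O.valuation (G s) < ∏ j, O.valuation (y j) ^ (m j)) → s ≠ 0 →
      ∀ (s' : ℕ) (m : Fin n → ℤ), 0 < s' → s' < p →
        O.valuation θ ^ s' ≠ ∏ i, O.valuation (x i) ^ (m i) := by
    intro s _ hs hs0
    have hne : (FL.filter fun μ => sf μ = s).Nonempty := by
      by_contra h0
      rw [Finset.not_nonempty_iff_eq_empty] at h0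
      have hG0 : G s = 0 := by rw [hG]; simp only [h0, Finset.sum_empty]
      refine hs fun m hm => ?_
      rw [hG0, map_zero]
      exact zero_lt_iff.mpr (hY0 m)
    obtain ⟨μ, hμ⟩ := hne
    obtain ⟨hμFL, hsμ⟩ := Finset.mem_filter.mp hμ
    exact (hdm μ hμFL).2.2.2 (by rw [hsμ]; exact hs0)
  have hGsmall := adValue_theta_separation O R hRO x hx lv hx0 hind hC2a hLA hC3 y lv' hy0 hvy1
    hC2a' c w hw hwi hxw ℓ ℓ₁ hℓ₁ θ ν₁ hν₁ hθν hθ0 G hGR hsepG htotsmall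
  -- ### hence `D^{p-1} · xN · zL ∈ J`
  set νp : Fin n → ℕ := fun j => (ν₁ j).toNat with hνp
  set νm : Fin n → ℕ := fun j => (-ν₁ j).toNat with hνm
  set Dp : K := ∏ j, y j ^ (νp j) with hDp
  set Dm : K := ∏ j, y j ^ (νm j) with hDm
  have hDpR : Dp ∈ R₁ := R₁.prod_mem fun j _ => R₁.pow_mem (hyR₁ j) _
  have hDmR : Dm ∈ R₁ := R₁.prod_mem fun j _ => R₁.pow_mem (hyR₁ j) _
  have hDm0 : Dm ≠ 0 := Finset.prod_ne_zero_iff.mpr fun j _ => pow_ne_zero _ (hy0 j)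
  have hθD : θ * Dm = Dp := by
    rw [hθν, hDm, hDp, ← Finset.prod_mul_distrib]
    refine Finset.prod_congr rfl fun j _ => ?_
    rw [← zpow_natCast, ← zpow_natCast, ← zpow_add₀ (hy0 j)]
    congr 1
    simp only [νp, νm]
    omega
  have hθsD : ∀ s : ℕ, s < p → Dm ^ (p - 1) * θ ^ s = Dp ^ s * Dm ^ (p - 1 - s) := by
    intro s hs
    have h1 : Dm ^ (p - 1) = Dm ^ (p - 1 - s) * Dm ^ s := by
      rw [← pow_add, Nat.sub_add_cancel (by omega)]
    rw [h1, ← hθD, mul_pow]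
    ring
  have JDxz : J (Dm ^ (p - 1) * (xN * ∑ μ ∈ FL, f μ)) := by
    rw [hregroup, Finset.mul_sum]
    refine Jsum _ _ fun s hs => ?_
    have hsp : s < p := Finset.mem_range.mp hs
    rw [← mul_assoc, hθsD s hsp, mul_comm]
    refine JI (G s) (hGR s) ((adValue_smallY_iff_mem O R hRO x hx lv hx0 hC3 y lv' hy0 hvy1
      hC2a' c w hw hwi hxw ℓ ℓ₁ hℓ₁ (hGR s)).mp (hGsmall s hs)) _ ?_
    exact R₁.mul_mem (R₁.pow_mem hDpR _) (R₁.pow_mem hDmR _)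
  -- ### `xN = y^{g₀} · W₀`
  set g₀ : Fin n → ℕ := fun j => ∑ i, c i j * N i with hg₀
  set W₀ : K := ∏ i, w i ^ (N i) with hW₀
  have hW₀iR : W₀⁻¹ ∈ R := by
    rw [hW₀, ← Finset.prod_inv_distrib]
    exact R.prod_mem fun i _ => by rw [← inv_pow]; exact R.pow_mem (hwi i) _
  have hW₀0 : W₀ ≠ 0 := Finset.prod_ne_zero_iff.mpr fun i _ => pow_ne_zero _
    (fun h => hx0 i (by rw [hxw i, h, mul_zero]))
  have hxNg : xN = (∏ j, y j ^ (g₀ j)) * W₀ := by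
    have h1 : ∀ i, x i ^ N i = (∏ j, y j ^ (c i j * N i)) * w i ^ N i := fun i => by
      rw [hxw i, mul_pow, ← Finset.prod_pow]
      congr 1
      exact Finset.prod_congr rfl fun j _ => (pow_mul _ _ _).symm
    rw [hxN, Finset.prod_congr rfl (fun i _ => h1 i), Finset.prod_mul_distrib, hW₀]
    congr 1
    rw [Finset.prod_comm]
    exact Finset.prod_congr rfl fun j _ => Finset.prod_pow_eq_pow_sum _ _ _
  have hg₀supp : ∀ j, ℓ ≤ lv' j → g₀ j = 0 := by
    intro j hj
    refine Finset.sum_eq_zero fun i _ => ?_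
    by_cases hi : ℓ₁ ≤ lv i
    · rw [hN0 i hi, mul_zero]
    · have hci : c i j = 0 := by
        by_contra hc
        exact hi ((hℓ₁ i).mp ⟨j, hj, hc⟩)
      rw [hci, zero_mul]
  -- ### the multiplier `g = g₀ + (p - 1) νm`
  have hνm0 : ∀ j, ℓ ≤ lv' j → νm j = 0 := fun j hj => by
    simp only [hνm, hν₁ j hj, neg_zero, Int.toNat_zero]
  refine ⟨fun j => g₀ j + (p - 1) * νm j, fun j hj => by
    simp only [hg₀supp j hj, hνm0 j hj, mul_zero, add_zero], ?_⟩
  have hyg : (∏ j, y j ^ (g₀ j + (p - 1) * νm j)) = (∏ j, y j ^ (g₀ j)) * Dm ^ (p - 1) := by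
    rw [hDm, ← Finset.prod_pow, ← Finset.prod_mul_distrib]
    exact Finset.prod_congr rfl fun j _ => by rw [pow_add, pow_mul']
  have hygR : (∏ j, y j ^ (g₀ j + (p - 1) * νm j)) ∈ R₁ :=
    R₁.prod_mem fun j _ => R₁.pow_mem (hyR₁ j) _
  have Jfinal : J ((∏ j, y j ^ (g₀ j + (p - 1) * νm j)) * z) := by
    rw [hzsplit, mul_add]
    refine Jadd _ _ ?_ ?_
    · have heq : (∏ j, y j ^ (g₀ j + (p - 1) * νm j)) * ∑ μ ∈ FL, f μ =
          Dm ^ (p - 1) * (xN * ∑ μ ∈ FL, f μ) * W₀⁻¹ := by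
        rw [hyg, hxNg]
        field_simp
      rw [heq]
      exact Jmul _ _ JDxz (hRR₁ hW₀iR)
    · rw [mul_comm]
      exact Jmul _ _ JH hygR
  obtain ⟨b, hb, heq⟩ := Jfinal
  exact ⟨b, hb, heq⟩

end Saturation

/-- Registered anchor of this helper file: quotients of monomials with exponents in `ℕ`. -/
theorem adValue_anchor_saturation : ∀ (K : Type) [Field K] (n : ℕ) (y : Fin n → K), (∀ j, y j ≠ 0) → ∀ (a b : Fin n → ℕ), (∀ i, b i ≤ a i) → (∏ i, y i ^ (a i)) * (∏ i, y i ^ (b i))⁻¹ = ∏ i, y i ^ (a i - b i) := by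
  intro K _ n y hy0 a b hab
  rw [← Finset.prod_inv_distrib, ← Finset.prod_mul_distrib]
  exact Finset.prod_congr rfl fun i _ => (pow_sub₀ _ (hy0 i) (hab i)).symm

end Summit.ResolutionOfSingularities.ResolutionOfSingularities.Theorems.PfaffLine

end
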